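import Literature.MathematicalPhysics.QuantumFieldTheory.Balaban1983to89.B6GOneLevelV1Bridge
import Literature.MathematicalPhysics.QuantumFieldTheory.Balaban1983to89.B5HkOpLandauMin
import Summits.QuantumFields.YangMills.Theorems.UnitScaleTiltProp7FlatCoercivityR
import HarnessLib

/-!
# Route `UnitScaleTilt`, crux K1 child «MinimiserStabilityRegPr» (stmt-QuantumFields-19200), leaves V2′ (one-step halving, Sect. F) and V3 (Prop. 7):
# **PRINT'S MINIMAL-EXTENSION OPERATOR `H` AT THE SETUP TORUS — ITS LANDAU CONDITION `R∂*(Hb) = 0` AND ITS MINIMUM PROPERTY `½‖∂(Hb)‖² ≤ ½‖∂A‖²` ON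
# `{Q_j A = b}`, IN V1 LETTERS, BY BRIDGE** (completes `UnitScaleTiltProp8FlatMinimizerH`: `Q_j(Hb) = b`, `|Hb| ≤ Cβ`, `L^j|∇Hb| ≤ Cβ`)

Cell `ym3-torus` (HUMAN RULING D-0037, YM ladder rung R3), seat `ym3-torus-p1` gen 14 (UV side); memo HOME/UV3-NODE.md §23.  `--supports
stmt-QuantumFields-19200 --as helper`.  Fifth file of pillar F3 «flat-operator bridge» (OWNER RULING g20-№8 §A).  [Balaban1984PropagatorsI] p. 29: *«we can verify all
the properties of H_kB: Q_kH_kB = B, R∂*H_kB = 0, H_kB is a minimum of ½⟨∂A, ∂A⟩ on the hyperplane {A : Q_kA = B, R∂*A = 0}»*; [Balaban1985Variational] (45) p. 285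
(the same `H` one level up: «L^jηQ_jHB = B»; (47) uses the chart `A = A′ − HD(A′)` inside `{R∂*A = 0}`).  The V1 field is the one of `…FlatMinimizerH`:
`Hb := tV⁻¹(pullR(H_k·cplx(tB b)))` = pub-balaban's `B5HkOpLandauMin.hkT` read back on the Setup torus.
* `eq_zero_of_TS_eq_zero` (injectivity of r03's scalar transport).
* **`RE_dsE_H_eq_zero`** — `RE (twoScale j hj1 ∅) (L^j) (dsE (L^j) (Hb)) = 0`: print's residual-gauge projection `R` of [Balaban1984PropagatorsII] (2.12) (= [B5] (1.70)
  `I − P`, r03's `B6ProjR212TorusBridge.RE_bridge_twoScale_empty`) kills the V1 divergence of `Hb` — from p16's `hkT_mem_Lan` + `mem_Lan_iff_RT` and r03's `divS_TV`; the letters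
  are those of the item's `Prop7FlatCoercivityR.flat_coercive_R` (the `‖R∂^*A‖²` term there VANISHES at `A = Hb`).
* **`curlAction_H_le`** — for every real fine bond field `A` with `bondAvgIter j A = b`: `curlAction (η^d) (L^j) (Hb) ≤ curlAction (η^d) (L^j) A`, `η = L^{−j}` — the minimum over
  the WHOLE fibre `{Q_jA = b}` (p21's `half_formDk_le_actionEta` + `actionEta_pullR_HkOp`, read through p16's `actionEta_tV`/`Qk_tV`).
Every `P : Params`, every `j` (`j + 1 ≤ m + K` for the Landau condition, `j ≤ m + K` for the minimum).  HONEST SCOPE: flat (`U = 1`), one level; uniqueness of the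
minimiser in the Landau fibre (pub-balaban `eq_hkT_of_mem_landauMin`, `d ≥ 2`) not re-read.  No definition, no sorry, standard axioms.  NOT a claim about the mass gap.

References: T. Bałaban, CMP **95** (1984) 17–40 [Balaban1984PropagatorsI] p.29, (1.38) p.24, (1.64)–(1.65) p.29, (1.70) p.29; CMP **96** (1984) 223–250
[Balaban1984PropagatorsII] (2.12) p.225; CMP **102** (1985) 277–309 [Balaban1985Variational] (45)–(47) p.285.
-/

set_option autoImplicit false

noncomputable section

open scoped BigOperators InnerProductSpace Matrix ComplexConjugate

namespace Summit.QuantumFields.YangMills.Theorems.FlatMinimizerHLandau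

open Literature.MathematicalPhysics.QuantumFieldTheory.Balaban1983to89
open Literature.MathematicalPhysics.QuantumFieldTheory.BalabanImbrieJaffe1984to88.BIJ85AxialPropagator411 (BondSpace)
open LatticeFieldCalculus B6SectADomainsV1 B6SectAOperatorsV1 B6SectAVectorModelV1 B6SectCTwoScaleV1 B6GOneLevelV1Bridge
open B6ProjR212TorusBridge (RE_bridge_twoScale_empty)
open B5Eq117TorusCarriers (Mk EK tV tB Qk_tV actionEta_tV)
open B5Prop11Plancherel (Tor fine)
open B5SectBStatements (Fld Qk cplx actionEta eta)
open B5TowerOneStroke (towerE pullR half_formDk_le_actionEta actionEta_pullR_HkOp)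
open B5HkOpLandauMin (hkT hkT_def hkT_mem_Lan mem_Lan_iff_RT)
open B5Hk163Torus (HkOp)

variable {P : Params} {j : ℕ}

/-- the scalar transport `TS` is injective on V1 gauge functions: `TS f = 0 → f = 0`. [cite: Balaban1984PropagatorsI, (1.4) p.18] -/
theorem eq_zero_of_TS_eq_zero (hj : j ≤ P.m + P.K) (f : ScalarSpace P) (h : TS hj f = 0) : f = 0 := by
  ext x
  have hx := congrFun h (EK hj x)
  rw [TS_apply, Equiv.symm_apply_apply, Pi.zero_apply, Complex.ofReal_eq_zero] at hx
  simpa using hx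

/-- **PRINT'S LANDAU CONDITION FOR `H`: `R∂*(Hb) = 0`** in the letters of the fleet's `Prop7FlatCoercivityR.flat_coercive_R` (`R = B6SectAOperatorsV1.RE`
of the one-level structure `twoScale j hj1 ∅`, `∂* = dsE (L^j)`), for the flat `H` of `UnitScaleTiltProp8FlatMinimizerH` (`Hb = tV⁻¹(pullR(H_k·cplx(tB b)))` =
pub-balaban's `hkT`): [B5] p. 29 «R∂*H_kB = 0» (p16's `B5HkOpLandauMin.hkT_mem_Lan` + `mem_Lan_iff_RT`) through r03's `RE_bridge_twoScale_empty` («(2.12) R IS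
(1.70) I − P») and `divS_TV`. [cite: Balaban1984PropagatorsI, p.29 «R∂*H_kB = 0»; Balaban1985Variational, (45) p.285] -/
theorem RE_dsE_H_eq_zero (hj1 : j + 1 ≤ P.m + P.K) (b : VecField P j ℝ) :
    RE (twoScale j hj1 (∅ : Finset (Site P (j + 1)))) ((P.L : ℝ) ^ j)
      (dsE ((P.L : ℝ) ^ j) (WithLp.toLp 2 ((tV (Nat.le_of_succ_le hj1)).symm
        (pullR P.L (Mk P j) j (HkOp (P.L ^ j) (Mk P j) *ᵥ cplx (tB b)))))) = 0 := by
  haveI : NeZero P.L := ⟨P.L_pos.ne'⟩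
  have hj : j ≤ P.m + P.K := Nat.le_of_succ_le hj1
  set xH : BondSpace P := WithLp.toLp 2 ((tV hj).symm (pullR P.L (Mk P j) j (HkOp (P.L ^ j) (Mk P j) *ᵥ cplx (tB b)))) with hxH
  apply eq_zero_of_TS_eq_zero hj
  have h1 := RE_bridge_twoScale_empty hj1 (c := (P.L : ℝ) ^ j) (pow_ne_zero j (Nat.cast_ne_zero.2 P.L_pos.ne')) (dsE ((P.L : ℝ) ^ j) xH)
  -- `TS (dsE xH) = divS (TV xH)` and `TV xH = trC (towerE) (cplx (hkT …))`
  have h2 : TV hj xH = B5TowerOneStroke.trC (towerE P.L (Mk P j) j) (cplx (hkT P.L (Mk P j) j (tB b))) := by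
    show B5TowerOneStroke.trC (towerE P.L (Mk P j) j) (cplx (tV hj (WithLp.ofLp xH))) = _
    rw [hxH, WithLp.ofLp_toLp, LinearEquiv.apply_symm_apply, hkT_def]
  have h3 := (mem_Lan_iff_RT P.L (Mk P j) j _).mp (hkT_mem_Lan P.L (Mk P j) j (tB b))
  rw [← h2, divS_TV hj xH] at h3
  show TS hj (RE (twoScale j hj1 ∅) ((P.L : ℝ) ^ j) (dsE ((P.L : ℝ) ^ j) xH)) = 0
  rw [show TS hj (RE (twoScale j hj1 ∅) ((P.L : ℝ) ^ j) (dsE ((P.L : ℝ) ^ j) xH))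
      = B5TowerOneStroke.trS (towerE P.L (Mk P j) j) (B5SectBStatements.cplxS (B5Eq117TorusCarriers.tS hj
          (WithLp.ofLp (RE (twoScale j hj1 ∅) ((P.L : ℝ) ^ j) (dsE ((P.L : ℝ) ^ j) xH))))) from rfl, h1]
  exact h3

/-- **PRINT'S MINIMUM PROPERTY FOR `H`: `Hb` MINIMISES `½‖∂A‖²` OVER THE WHOLE FIBRE `{Q_j A = b}`** (in V1 letters: `curlAction (η^d) (L^j)`,
`η = L^{−j}` = `B5SectBStatements.eta`): for every real fine bond field `A` with `bondAvgIter j A = b`, `curlAction … (Hb) ≤ curlAction … A` — [B5] p. 29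
«H_kB is a minimum of ½⟨∂A, ∂A⟩ on the hyperplane {A : Q_kA = B, R∂*A = 0}» (in fact on all of `{Q_kA = B}`: p21's `half_formDk_le_actionEta` +
`actionEta_pullR_HkOp`, read through p16's `actionEta_tV`/`Qk_tV`). [cite: Balaban1984PropagatorsI, p.29, (1.64)-(1.65); Balaban1985Variational, (45) p.285] -/
theorem curlAction_H_le (hj : j ≤ P.m + P.K) (b : VecField P j ℝ) (A : VecField P 0 ℝ) (hA : bondAvgIter j A = b) :
    curlAction (eta P.L j ^ P.d) ((P.L : ℝ) ^ j)
        ((tV hj).symm (pullR P.L (Mk P j) j (HkOp (P.L ^ j) (Mk P j) *ᵥ cplx (tB b))))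
      ≤ curlAction (eta P.L j ^ P.d) ((P.L : ℝ) ^ j) A := by
  haveI : NeZero P.L := ⟨P.L_pos.ne'⟩
  rw [← actionEta_tV hj, ← actionEta_tV hj, LinearEquiv.apply_symm_apply, ← hkT_def, hkT_def, actionEta_pullR_HkOp]
  refine half_formDk_le_actionEta P.L (Mk P j) j (tB b) (tV hj A) ?_
  rw [Qk_tV, hA]

section T3

open T3ContinuumYM3Torus (T3Family)
open Prop7FlatCoercivityR (succ_le_T3)

/-- **AT THE d = 3 CARRIER** (`j = K − n`): the Landau condition of the flat `H` in the letters of `Prop7FlatCoercivityR.flat_coercive_R_T3`.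
[cite: Balaban1984PropagatorsI, p.29 «R∂*H_kB = 0»] -/
theorem RE_dsE_H_eq_zero_T3 (F : T3Family) (n K : ℕ) (b : VecField (F.P K) (K - n) ℝ) :
    RE (twoScale (K - n) (succ_le_T3 F n K) (∅ : Finset (Site (F.P K) (K - n + 1)))) ((F.L : ℝ) ^ (K - n))
      (dsE ((F.L : ℝ) ^ (K - n)) (WithLp.toLp 2 ((tV (Nat.le_of_succ_le (succ_le_T3 F n K))).symm
        (pullR (F.P K).L (Mk (F.P K) (K - n)) (K - n) (HkOp ((F.P K).L ^ (K - n)) (Mk (F.P K) (K - n)) *ᵥ cplx (tB b)))))) = 0 :=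
  RE_dsE_H_eq_zero (P := F.P K) (succ_le_T3 F n K) b

/-- **AT THE d = 3 CARRIER**: the flat `H b` minimises `curlAction (η³) (L^{K−n})` over `{A : bondAvgIter (K−n) A = b}`.
[cite: Balaban1984PropagatorsI, p.29, (1.64)-(1.65)] -/
theorem curlAction_H_le_T3 (F : T3Family) (n K : ℕ) (b : VecField (F.P K) (K - n) ℝ) (A : VecField (F.P K) 0 ℝ)
    (hA : bondAvgIter (K - n) A = b) :
    curlAction (eta F.L (K - n) ^ 3) ((F.L : ℝ) ^ (K - n))
        ((tV (Nat.le_of_succ_le (succ_le_T3 F n K))).symm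
          (pullR (F.P K).L (Mk (F.P K) (K - n)) (K - n) (HkOp ((F.P K).L ^ (K - n)) (Mk (F.P K) (K - n)) *ᵥ cplx (tB b))))
      ≤ curlAction (eta F.L (K - n) ^ 3) ((F.L : ℝ) ^ (K - n)) A :=
  curlAction_H_le (P := F.P K) (Nat.le_of_succ_le (succ_le_T3 F n K)) b A hA

end T3

end Summit.QuantumFields.YangMills.Theorems.FlatMinimizerHLandau

end
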